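import Summits.CriticalPhenomena.PercolationContinuityZ3.Theorems.PercNearOneGluingNoHeavyQuantFarLayerOneTreeObserverBelow
import HarnessLib

/-!
# QUANT lane R8, front "FAR beyond trees" — layer one of FAR on a pendant forest on a cycle observed from ANY TREE VERTEX

builds on p205010 (kernel theorem, internal audit signed; external expert review pending)

Support file (`--supports stmt-CriticalPhenomena-4575`), seat `prim-quant-p1` (gen 18); memo
`run/shared/lean/prim/quant/prim-quant-p1-g18/FOR-PROVERS-FLATTENING-FC.md` §1 (wrapper R3, completing R2/R4).  No definitions; standard axioms; no sorries.

For a pendant forest on a cycle (`Bundle.PForest`, cycle presented so that the observer's tree hangs at `c_0`) and an observer `o` in a tree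
(`Bundle.Below T par (cyc 0) o`: the parent chain of `o` stays in `T` and reaches `c_0`), layer one of FAR holds at `o` given `SunFAR K 1` for all
`K ≥ 2`: by induction on `|T| +` (stalk length) — `o ∈ A` (`layerOne_of_observer_mem`); relays on both sides of `o` (`layerOne_of_pforest_treeObs_twoSides`);
all relays below `o` (`layerOne_of_pforest_treeObs_allBelow`); no relay below `o`: prune a deepest vertex below `o` (`TwoCopy.farp_iff_of_pendant`) or, when
`o` is a leaf, move the observer to `par o` (`layerOne_of_pendant_observer`), ending at `c_0` with `layerOne_of_pforest_of_sunFAR`.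
* **`Quant.Bundle.layerOne_of_pforest_treeObs_of_sunFAR`**.  With `layerOne_of_pforest_of_sunFAR` (observer on the cycle) this is layer one of
  `Quant.FarRelayRow` for EVERY observer of every pendant forest on a cycle, i.e. on every unicyclic support, modulo `SunFAR K 1` (all `K`).
[cite: KozmaNitzan2024, Conjecture 3 (p. 15)]; [cite: Grimmett1999, §1.3 p. 10]; [this work].
-/

noncomputable section

namespace Summit.CriticalPhenomena.PercolationContinuityZ3.Theorems

namespace Quant

namespace Bundle

open Finset MeasureTheory Set
open Literature.Probability.LatticeModels
open Literature.Probability.Percolation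
open Summit.CriticalPhenomena.PercolationContinuityZ3.Theorems.HairyCycle (SunFAR)
open scoped Classical

variable {n : ℕ}

section TreeObsAll

variable {L : ℕ} {cyc : ℕ → Fin n} {idx : Fin n → ℕ}

/-- Along a parent chain inside `T` the ranking does not increase. [this work] -/
theorem dep_chain_le {T : Finset (Fin n)} {par : Fin n → Fin n} {dep : Fin n → ℕ} {w : Sym2 (Fin n) → unitInterval}
    (P : PForest L cyc idx T par dep w) {o : Fin n} {k : ℕ} (hchain : ∀ j, j ≤ k → par^[j] o ∈ T) :
    ∀ j, j ≤ k → dep (par^[j] o) ≤ dep o := by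
  intro j hj
  rcases Nat.eq_zero_or_pos j with rfl | hpos
  · simp
  · obtain ⟨j', rfl⟩ : ∃ j', j = j' + 1 := ⟨j - 1, by omega⟩
    exact (dep_iterate_lt P j' fun i hi => hchain i (by omega)).le

/-- A vertex below `o ∈ T` has a larger ranking. [this work] -/
theorem dep_lt_of_below {T : Finset (Fin n)} {par : Fin n → Fin n} {dep : Fin n → ℕ} {w : Sym2 (Fin n) → unitInterval}
    (P : PForest L cyc idx T par dep w) {o v : Fin n} (hoT : o ∈ T) (h : Below T par o v) : dep o < dep v := by
  obtain ⟨k, hk, hchain⟩ := h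
  have hall : ∀ j, j ≤ k + 1 → par^[j] v ∈ T := by
    intro j hj
    rcases Nat.lt_or_ge j (k + 1) with hlt | hge
    · exact hchain j (by omega)
    · have : j = k + 1 := by omega
      rw [this, hk]; exact hoT
  have := dep_iterate_lt P k hall
  rwa [hk] at this

/-- **Layer one of FAR from a TREE observer** of a pendant forest on a cycle whose tree hangs at `c_0`, given `SunFAR K 1` for all `K ≥ 2`.
Induction on `|T| + (length of the stalk from o to c_0)`. [this work] -/
theorem layerOne_of_pforest_treeObs_of_sunFAR (hS : ∀ K, 2 ≤ K → SunFAR K 1) (A : Finset (Fin n)) :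
    ∀ (m : ℕ) (T : Finset (Fin n)) (par : Fin n → Fin n) (dep : Fin n → ℕ) (w : Sym2 (Fin n) → unitInterval) (o : Fin n) (k : ℕ),
      PForest L cyc idx T par dep w → T.card + k ≤ m → par^[k + 1] o = cyc 0 → (∀ j, j ≤ k → par^[j] o ∈ T) →
      (∀ a ∈ A, a ∈ T ∨ ∃ i, i < L ∧ a = cyc i) → ∀ t : ℝ,
      (2 : ℝ) < ∑ a ∈ A, (prodBernoulli w).real (openConn o a) →
      (∀ a ∈ A, (prodBernoulli w).real (openConn o a : Set (BondConfig (Fin n)))ᶜ ≤ t) →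
      (prodBernoulli w).real {ω : BondConfig (Fin n) | (A.filter fun a => ω ∈ openConn o a).card ≤ 1} ≤ t := by
  intro m
  induction m using Nat.strong_induction_on with
  | _ m IH =>
  intro T par dep w o k P hm hk hchain hA t hEN hcut
  have hmeas : ∀ U : Set (BondConfig (Fin n)), MeasurableSet U := fun U => (Set.toFinite U).measurableSet
  have hoT : o ∈ T := by simpa using hchain 0 (Nat.zero_le k)
  have hK : 2 ≤ A.card := by
    have hle : ∑ a ∈ A, (prodBernoulli w).real (openConn o a) ≤ ∑ _a ∈ A, (1 : ℝ) := sum_le_sum fun a _ => measureReal_le_one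
    rw [sum_const, nsmul_eq_mul, mul_one] at hle
    have : (2 : ℝ) < A.card := by linarith
    exact_mod_cast this.le
  -- (a) the observer is a relay
  by_cases hoA : o ∈ A
  · exact layerOne_of_observer_mem w A hoA t hEN hcut
  -- (b)/(c)/(d)
  by_cases h1 : ∃ a ∈ A, Below T par o a
  · by_cases h2 : ∃ b ∈ A, ¬ Below T par o b
    · -- (b) relays on both sides
      exact layerOne_of_pforest_treeObs_twoSides P hoT A h1 h2 t hEN hcut
    · -- (c) all relays below `o`
      push Not at h2
      exact layerOne_of_pforest_treeObs_allBelow P hoT A h2 (hS _ hK) t hEN hcut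
  push Not at h1
  -- (d) no relay below `o`
  by_cases hdesc : (T.filter fun v => Below T par o v).Nonempty
  · -- (d1) prune a deepest vertex below `o` (a non-relay leaf)
    obtain ⟨v, hvS, hvmax⟩ := (T.filter fun v => Below T par o v).exists_max_image dep hdesc
    have hvT : v ∈ T := (mem_filter.1 hvS).1
    have hvb : Below T par o v := (mem_filter.1 hvS).2
    have hvA : v ∉ A := fun h => h1 v h hvb
    have hleaf : ∀ d ∈ T, par d ≠ v := by
      intro d hd hdv
      have hdb : Below T par o d := below_of_par_below hd hdv hvb
      have h1' := hvmax d (mem_filter.2 ⟨hd, hdb⟩)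
      have h2' := P.dep_lt d hd (by rw [hdv]; exact hvT)
      rw [hdv] at h2'; omega
    have hov : o ≠ v := fun h => not_below_self P hoT (h ▸ hvb)
    have hpend := P.pendant_of_leaf hvT hleaf
    have P' : PForest L cyc idx (T.erase v) par dep (Function.update w s(v, par v) 0) := by
      refine ⟨P.hL, P.hcyc, P.hidx, fun i hi h => P.cyc_notMem i hi (mem_of_mem_erase h), ?_, ?_, ?_⟩
      · intro u hu
        have huT := mem_of_mem_erase hu
        rcases P.par_mem u huT with hp | hp
        · left; exact mem_erase.2 ⟨fun h => hleaf u huT h, hp⟩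
        · exact Or.inr hp
      · intro u hu hp; exact P.dep_lt u (mem_of_mem_erase hu) (mem_of_mem_erase hp)
      · intro x y hxy hw
        have hne : s(x, y) ≠ s(v, par v) := by
          intro h; rw [h, Function.update_self] at hw; exact hw rfl
        rw [Function.update_of_ne hne] at hw
        rcases P.supp x y hxy hw with h | ⟨hx, h⟩ | ⟨hy, h⟩
        · exact Or.inl h
        · right; left
          refine ⟨mem_erase.2 ⟨fun hxc => hne ?_, hx⟩, h⟩
          subst hxc; rw [h]
        · right; right
          refine ⟨mem_erase.2 ⟨fun hyc => hne ?_, hy⟩, h⟩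
          subst hyc; rw [h, Sym2.eq_swap]
    -- the stalk of `o` avoids `v` (rankings)
    have hov' : ∀ j, j ≤ k → par^[j] o ≠ v := by
      intro j hj h
      have h1' := dep_chain_le P hchain j hj
      have h2' := dep_lt_of_below P hoT hvb
      rw [h] at h1'; omega
    have hchain' : ∀ j, j ≤ k → par^[j] o ∈ T.erase v := fun j hj => mem_erase.2 ⟨hov' j hj, hchain j hj⟩
    have hA' : ∀ a ∈ A, a ∈ T.erase v ∨ ∃ i, i < L ∧ a = cyc i := by
      intro a ha
      rcases hA a ha with h | h
      · left; exact mem_erase.2 ⟨fun hav => hvA (hav ▸ ha), h⟩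
      · exact Or.inr h
    have hm' : (T.erase v).card + k < m := by rw [card_erase_of_mem hvT]; have := card_pos.2 ⟨v, hvT⟩; omega
    have key : TwoCopy.FARp (Function.update w s(v, par v) 0) A o 1 :=
      fun hEN' t' hcut' => IH _ hm' (T.erase v) par dep _ o k P' le_rfl hk hchain' hA' t' (by push_cast at hEN'; linarith) hcut'
    exact ((TwoCopy.farp_iff_of_pendant w A o 1 (P.par_ne hvT) hvA hov hpend).2 key) (by push_cast; linarith) t hcut
  · -- (d2) `o` is a leaf: move the observer to `par o`
    rw [Finset.not_nonempty_iff_eq_empty] at hdesc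
    have hleafo : ∀ c ∈ T, par c ≠ o := by
      intro c hc hco
      have : c ∈ T.filter fun v => Below T par o v := mem_filter.2 ⟨hc, below_of_par_eq hc hco⟩
      rw [hdesc] at this; exact absurd this (Finset.notMem_empty c)
    have hpend : ∀ x : Fin n, x ≠ o → x ≠ par o → w s(o, x) = 0 := P.pendant_of_leaf hoT hleafo
    refine layerOne_of_pendant_observer w (P.par_ne hoT).symm hpend A hoA (fun t' hEN' hcut' => ?_) t hEN hcut
    -- the instance at `par o`
    rcases Nat.eq_zero_or_pos k with hk0 | hkpos
    · -- `par o = c_0`: the on-cycle theorem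
      subst hk0
      have hpo : par o = cyc 0 := by simpa using hk
      rw [hpo] at hEN' hcut' ⊢
      exact layerOne_of_pforest_of_sunFAR hS P A hA t' hEN' hcut'
    · -- `par o ∈ T`: induction (shorter stalk)
      obtain ⟨k', rfl⟩ : ∃ k', k = k' + 1 := ⟨k - 1, by omega⟩
      have hk' : par^[k' + 1] (par o) = cyc 0 := by rw [← Function.iterate_succ_apply]; exact hk
      have hchain' : ∀ j, j ≤ k' → par^[j] (par o) ∈ T := by
        intro j hj; rw [← Function.iterate_succ_apply]; exact hchain (j + 1) (by omega)
      exact IH _ (by omega) T par dep w (par o) k' P le_rfl hk' hchain' hA t' hEN' hcut'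

end TreeObsAll

end Bundle

end Quant

end Summit.CriticalPhenomena.PercolationContinuityZ3.Theorems
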